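import Summits.QuantumFields.BalabanUV.T4Continuum.Support.NE7GeodesicParameter
import HarnessLib

/-!
# T⁴ programme, row NE7 — (154d) ONE DIRECTION OF THE CORNER-GAUGE INTERPOLATION: the smoothstep-geodesic filling
# `g′ y = geo (φ(res_j y ∕ M)) (g ⌊y⌋_j) (g (⌊y⌋_j + M e_j))` and its first ∕ second lattice differences (`NE7CornerGaugeStep`)

Cell `pub-balaban`, lineage `t4-ne7-p2` (CRUX PROVER NE7 #2), gen 86; fourth file of the kernel chain (154) (road (β′) of
PRICING-NE7 §419 ∕ `g85/HFLATTOP-MEMO.md` §4).  ONE STEP of the construction: a unitary lattice map `g : ℤ^d → U(𝔸)` that is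
piecewise constant on the blocks of side `M` in direction `j` (coarse oscillation `‖g(y + M e_j) − g y‖ ≤ Ω ≤ 1∕4`) is replaced,
inside every block and along direction `j`, by the two-point geodesic between its values on the two faces, at the SMOOTHSTEP
parameter `φ(r∕M) = 3(r∕M)² − 2(r∕M)³`, `r = res M y j`:
  `g′ y = geo (φ(res M y j ∕ M)) (g (y − res M y j • e_j)) (g (y − res M y j • e_j + M • e_j))`.
No definition is introduced: `g′` is ANY map satisfying this equation (hypothesis `hdef`), so that the iteration (154e) can run
the step inside an existential induction.  Proved here, with the constants of (154b)∕(154c):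
§1 structure: `g′` is unitary, agrees with `g` at the corners `M•z`, inherits `M·N`-periodicity and piecewise constancy in the
other directions, and `g′ (y + e_j)` is the SAME geodesic at the next parameter `φ((r+1)∕M)` (also across the block face,
by `φ(0) = 0`, `φ(1) = 1`);
§2 direction `j`: `‖g′(y+e_j) − g′ y‖ ≤ 6Ω∕M`, `‖Δ_jΔ_j g′‖ ≤ 24Ω∕M² + 36Ω²∕M²`;
§3 a direction `μ ≠ j` where `g` has differences `≤ l`: `‖g′(y+e_μ) − g′ y‖ ≤ (1 + 24Ω)·l` (SHARP: no loss beyond `O(Ω)`), the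
same for coarse translations `M•e_κ`, the mixed second difference `‖Δ_τΔ_j g′‖ ≤ (3∕(2M))·l·(4Ω(1+24Ω) + 8)`, and for two
directions `μ, τ ≠ j` with sides `l, m` and second differences `≤ σ`: `‖Δ_τΔ_μ g′‖ ≤ σ + 53Ω·σ + 115·l·m`.

HONEST FRAMING (page 1): [folklore] lattice interpolation kinematics over (154a–c) and the tree's `UnitaryGeodesic` ∕
`SmoothRefineBlocks`; constants are the files', not optimised.  Nothing of Bałaban's; (APE) NOT proved; THE END's `hflatTop`
is NOT yet discharged here (that needs (154e) + the re-gauging bookkeeping); NE7 NOT PRINTED ∕ NOT PROVED; spine 0∕9; finite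
T⁴ rung (B)+1 — NOT infinite volume, NOT mass gap, NOT Clay.  No `sorry`.  PLACEMENT: our lemma, `Summits/QuantumFields/BalabanUV/`.
Continuum YM on T⁴ ⇐ BetaPertH ∧ nine spine estimates (0/9 proved); BetaPertH ⇐ (D1) ∧ (D4) ∧ CAP+tail; G-an2-4 gates asym, D1 and NE2/3/4.
-/

set_option autoImplicit false

open NormedSpace

namespace Summit.QuantumFields.BalabanUV.T4Continuum.NE7CornerGaugeStep

open Literature.MathematicalPhysics.QuantumFieldTheory.Balaban1983to89
open MatrixLog B7Prop1Explicit B7Prop2Explicit UnitaryRootInterpolation UnitaryGeodesic NE7ExpLogSecondOrder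
  NE7GeodesicSecondOrder NE7GeodesicParameter SmoothRefineBlocks

noncomputable section

variable {𝔸 : Type*} [CStarAlgebra 𝔸] [Nontrivial 𝔸] {d M : ℕ} {j : Fin d} {g g' : Site d → 𝔸ˣ} {Ω : ℝ}

/-! ## §1 Structure of the step -/

omit [Nontrivial 𝔸] in
/-- The ratio of the two face values is `Ω`-close to `1`. [folklore] -/
theorem face_ratio_le (hgU : ∀ y, g y ∈ unitaryUnits 𝔸)
    (hgΩ : ∀ y, ‖(g (y + (M : ℤ) • e j) : 𝔸) - g y‖ ≤ Ω) (y : Site d) :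
    ‖((((g y)⁻¹ * g (y + (M : ℤ) • e j)) : 𝔸ˣ) : 𝔸) - 1‖ ≤ Ω := by
  rw [norm_ratio_sub_one (hgU y)]; exact hgΩ y

omit [Nontrivial 𝔸] in
/-- **`g′` is unitary** (`Ω ≤ 1∕4`). [folklore] -/
theorem step_unitary (hgU : ∀ y, g y ∈ unitaryUnits 𝔸)
    (hgΩ : ∀ y, ‖(g (y + (M : ℤ) • e j) : 𝔸) - g y‖ ≤ Ω) (hΩ4 : Ω ≤ 1 / 4)
    (hdef : ∀ y : Site d, g' y = geo (3 * (((res M y j : ℤ) : ℝ) / M) ^ 2 - 2 * (((res M y j : ℤ) : ℝ) / M) ^ 3)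
      (g (y - res M y j • e j)) (g (y - res M y j • e j + (M : ℤ) • e j))) (y : Site d) :
    g' y ∈ unitaryUnits 𝔸 := by
  rw [hdef y]
  exact geo_mem_unitaryUnits (hgU _) (hgU _) ((hgΩ _).trans hΩ4) _

omit [Nontrivial 𝔸] in
/-- **Corners are kept**: `g′ (M•z) = g (M•z)` (`res = 0`, `φ 0 = 0`, `geo 0 b₀ b₁ = b₀`). [folklore] -/
theorem step_corner (hM : 1 ≤ M)
    (hdef : ∀ y : Site d, g' y = geo (3 * (((res M y j : ℤ) : ℝ) / M) ^ 2 - 2 * (((res M y j : ℤ) : ℝ) / M) ^ 3)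
      (g (y - res M y j • e j)) (g (y - res M y j • e j + (M : ℤ) • e j))) (z : Site d) :
    g' ((M : ℤ) • z) = g ((M : ℤ) • z) := by
  have h := floor_corner hM z j
  rw [hdef, h.2, h.1]
  simp

omit [Nontrivial 𝔸] in
/-- **Periodicity is inherited**: if `g` is `M·N`-periodic in every direction, so is `g′`. [folklore] -/
theorem step_periodic (hM : 1 ≤ M) (N : ℕ) (hper : ∀ (y : Site d) (i : Fin d), g (y + ((M * N : ℕ) : ℤ) • e i) = g y)
    (hdef : ∀ y : Site d, g' y = geo (3 * (((res M y j : ℤ) : ℝ) / M) ^ 2 - 2 * (((res M y j : ℤ) : ℝ) / M) ^ 3)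
      (g (y - res M y j • e j)) (g (y - res M y j • e j + (M : ℤ) • e j))) (y : Site d) (i : Fin d) :
    g' (y + ((M * N : ℕ) : ℤ) • e i) = g' y := by
  have hc : ((M * N : ℕ) : ℤ) = (M : ℤ) * N := by push_cast; ring
  rw [hdef, hdef y, hc, floor_add_period hM y j i N, (blk_res_add_period hM y N i).2, add_right_comm _ (((M : ℤ) * N) • e i),
    ← hc, hper, hper]

omit [Nontrivial 𝔸] in
/-- **Piecewise constancy in another direction is inherited**: if `g (y − res M y κ • e_κ) = g y` for all `y` (`κ ≠ j`), the
same holds for `g′`. [folklore] -/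
theorem step_pwc (hM : 1 ≤ M) {κ : Fin d} (hκ : κ ≠ j) (hpwc : ∀ y : Site d, g (y - res M y κ • e κ) = g y)
    (hdef : ∀ y : Site d, g' y = geo (3 * (((res M y j : ℤ) : ℝ) / M) ^ 2 - 2 * (((res M y j : ℤ) : ℝ) / M) ^ 3)
      (g (y - res M y j • e j)) (g (y - res M y j • e j + (M : ℤ) • e j))) (y : Site d) :
    g' (y - res M y κ • e κ) = g' y := by
  rw [hdef, hdef y, res_floor_ne hM y hκ.symm]
  -- the two floors commute, and `g` forgets the `κ`-offset at the floored points
  have h1 : y - res M y κ • e κ - res M y j • e j = (y - res M y j • e j) - res M (y - res M y j • e j) κ • e κ := by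
    rw [res_floor_ne hM y hκ]; abel
  have h2 : y - res M y j • e j - res M (y - res M y j • e j) κ • e κ + (M : ℤ) • e j
      = (y - res M y j • e j + (M : ℤ) • e j) - res M (y - res M y j • e j + (M : ℤ) • e j) κ • e κ := by
    have : res M (y - res M y j • e j + (M : ℤ) • e j) κ = res M y κ := by
      have hp := (blk_res_add_period hM (y - res M y j • e j) 1 j).2
      rw [mul_one] at hp
      rw [hp, res_floor_ne hM y hκ]
    rw [this, res_floor_ne hM y hκ]; abel
  rw [h1, hpwc, h2, hpwc]

omit [Nontrivial 𝔸] in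
/-- **The next point along `j` lies on the same geodesic**: `g′ (y + e_j) = geo (φ((r+1)∕M)) (g ⌊y⌋_j) (g (⌊y⌋_j + M e_j))`,
`r = res M y j` — inside the block trivially, across the face by `φ 0 = 0`, `φ 1 = 1` (`geo 1 b₀ b₁ = b₁`). [folklore] -/
theorem step_succ (hM : 1 ≤ M) (hgU : ∀ y, g y ∈ unitaryUnits 𝔸)
    (hgΩ : ∀ y, ‖(g (y + (M : ℤ) • e j) : 𝔸) - g y‖ ≤ Ω) (hΩ4 : Ω ≤ 1 / 4)
    (hdef : ∀ y : Site d, g' y = geo (3 * (((res M y j : ℤ) : ℝ) / M) ^ 2 - 2 * (((res M y j : ℤ) : ℝ) / M) ^ 3)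
      (g (y - res M y j • e j)) (g (y - res M y j • e j + (M : ℤ) • e j))) (y : Site d) :
    g' (y + e j) = geo (3 * (((res M y j + 1 : ℤ) : ℝ) / M) ^ 2 - 2 * (((res M y j + 1 : ℤ) : ℝ) / M) ^ 3)
      (g (y - res M y j • e j)) (g (y - res M y j • e j + (M : ℤ) • e j)) := by
  by_cases h : res M y j = (M : ℤ) - 1
  · -- across the face: the new block starts (`φ 0 = 0`) where the old geodesic ends (`φ 1 = 1`)
    rw [hdef, floor_add_e_self_of_eq hM y j h, res_add_e_self hM y j, if_pos h, h]
    have hM0 : (M : ℝ) ≠ 0 := by exact_mod_cast (by omega : M ≠ 0)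
    have e1 : (3 * ((((M : ℤ) - 1 + 1 : ℤ) : ℝ) / M) ^ 2 - 2 * ((((M : ℤ) - 1 + 1 : ℤ) : ℝ) / M) ^ 3) = 1 := by
      push_cast; field_simp; ring
    have e0 : (3 * (((0 : ℤ) : ℝ) / (M : ℝ)) ^ 2 - 2 * (((0 : ℤ) : ℝ) / (M : ℝ)) ^ 3) = 0 := by simp
    rw [e1, e0, geo_zero, geo_one]
    exact (face_ratio_le hgU hgΩ _).trans_lt (hΩ4.trans_lt (by norm_num))
  · rw [hdef, floor_add_e_self_of_ne hM y j h, res_add_e_self hM y j, if_neg h]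

/-! ## §2 The new direction `j` -/

omit [Nontrivial 𝔸] in
/-- **First differences along `j`**: `‖g′(y + e_j) − g′ y‖ ≤ 6Ω∕M` (`|φ((r+1)∕M) − φ(r∕M)| ≤ 3∕(2M)`, parameter step of the
geodesic `≤ 4|Δs|Ω`). [folklore] -/
theorem step_dir_first (hM : 1 ≤ M) (hgU : ∀ y, g y ∈ unitaryUnits 𝔸)
    (hgΩ : ∀ y, ‖(g (y + (M : ℤ) • e j) : 𝔸) - g y‖ ≤ Ω) (hΩ4 : Ω ≤ 1 / 4)
    (hdef : ∀ y : Site d, g' y = geo (3 * (((res M y j : ℤ) : ℝ) / M) ^ 2 - 2 * (((res M y j : ℤ) : ℝ) / M) ^ 3)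
      (g (y - res M y j • e j)) (g (y - res M y j • e j + (M : ℤ) • e j))) (y : Site d) :
    ‖(g' (y + e j) : 𝔸) - g' y‖ ≤ 6 * Ω / M := by
  have hΩ0 : 0 ≤ Ω := (norm_nonneg _).trans (hgΩ y)
  have hr0 := res_nonneg hM y j
  have hrM : res M y j + 1 ≤ (M : ℤ) := by have := res_lt hM y j; omega
  have hs := sstep_step_le hM hr0 hrM
  rw [step_succ hM hgU hgΩ hΩ4 hdef y, hdef y]
  calc _ ≤ 4 * |(3 * (((res M y j + 1 : ℤ) : ℝ) / M) ^ 2 - 2 * (((res M y j + 1 : ℤ) : ℝ) / M) ^ 3)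
          - (3 * (((res M y j : ℤ) : ℝ) / M) ^ 2 - 2 * (((res M y j : ℤ) : ℝ) / M) ^ 3)| * Ω :=
        norm_geo_param_sub_le (hgU _) (hgU _) hΩ4 (hgΩ _) hs.2
    _ ≤ 4 * (3 / 2 / (M : ℝ)) * Ω := by gcongr; exact hs.1
    _ = 6 * Ω / M := by ring

/-- **Second differences along `j`**: `‖g′(y+2e_j) − 2g′(y+e_j) + g′ y‖ ≤ 24Ω∕M² + 36Ω²∕M²` — inside a block the three
points lie on one geodesic (`|Δ²φ| ≤ 6∕M²`, `|Δφ| ≤ 3∕(2M)`); at a face both increments are `≤ 4·(3∕M²)·Ω` by the flat ends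
of `φ`. [folklore] -/
theorem step_dir_second (hM : 1 ≤ M) (hgU : ∀ y, g y ∈ unitaryUnits 𝔸)
    (hgΩ : ∀ y, ‖(g (y + (M : ℤ) • e j) : 𝔸) - g y‖ ≤ Ω) (hΩ4 : Ω ≤ 1 / 4)
    (hdef : ∀ y : Site d, g' y = geo (3 * (((res M y j : ℤ) : ℝ) / M) ^ 2 - 2 * (((res M y j : ℤ) : ℝ) / M) ^ 3)
      (g (y - res M y j • e j)) (g (y - res M y j • e j + (M : ℤ) • e j))) (y : Site d) :
    ‖(g' (y + e j + e j) : 𝔸) - g' (y + e j) - g' (y + e j) + g' y‖ ≤ 24 * Ω / (M : ℝ) ^ 2 + 36 * Ω ^ 2 / (M : ℝ) ^ 2 := by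
  have hΩ0 : 0 ≤ Ω := (norm_nonneg _).trans (hgΩ y)
  have hM0 : (0 : ℝ) < M := by exact_mod_cast hM
  have hr0 := res_nonneg hM y j
  have hrlt := res_lt hM y j
  have hreg : (g' (y + e j + e j) : 𝔸) - g' (y + e j) - g' (y + e j) + g' y
      = ((g' (y + e j + e j) : 𝔸) - g' (y + e j)) - ((g' (y + e j) : 𝔸) - g' y) := by abel
  rw [hreg]
  by_cases h : res M y j = (M : ℤ) - 1
  · -- at the face: two small increments
    have hy' : res M (y + e j) j = 0 := by rw [res_add_e_self hM y j, if_pos h]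
    have hfl' : y + e j - res M (y + e j) j • e j = y - res M y j • e j + (M : ℤ) • e j := floor_add_e_self_of_eq hM y j h
    -- increment after the face
    have h2 : ‖(g' (y + e j + e j) : 𝔸) - g' (y + e j)‖ ≤ 4 * (3 / (M : ℝ) ^ 2) * Ω := by
      rw [step_succ hM hgU hgΩ hΩ4 hdef (y + e j), hdef (y + e j), hy']
      have hs := sstep_step_end_le hM (r := 0) (Or.inl rfl) le_rfl (by omega)
      have hs1 := (sstep_step_le hM (r := 0) le_rfl (by omega)).2
      calc _ ≤ 4 * |(3 * ((((0 : ℤ) + 1 : ℤ) : ℝ) / M) ^ 2 - 2 * ((((0 : ℤ) + 1 : ℤ) : ℝ) / M) ^ 3)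
              - (3 * (((0 : ℤ) : ℝ) / M) ^ 2 - 2 * (((0 : ℤ) : ℝ) / M) ^ 3)| * Ω :=
            norm_geo_param_sub_le (hgU _) (hgU _) hΩ4 (hgΩ _) hs1
        _ ≤ 4 * (3 / (M : ℝ) ^ 2) * Ω := by gcongr
    -- increment before the face
    have h1 : ‖(g' (y + e j) : 𝔸) - g' y‖ ≤ 4 * (3 / (M : ℝ) ^ 2) * Ω := by
      rw [step_succ hM hgU hgΩ hΩ4 hdef y, hdef y]
      have hs := sstep_step_end_le hM (r := res M y j) (Or.inr (by omega)) hr0 (by omega)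
      have hs1 := (sstep_step_le hM (r := res M y j) hr0 (by omega)).2
      calc _ ≤ 4 * |(3 * (((res M y j + 1 : ℤ) : ℝ) / M) ^ 2 - 2 * (((res M y j + 1 : ℤ) : ℝ) / M) ^ 3)
              - (3 * (((res M y j : ℤ) : ℝ) / M) ^ 2 - 2 * (((res M y j : ℤ) : ℝ) / M) ^ 3)| * Ω :=
            norm_geo_param_sub_le (hgU _) (hgU _) hΩ4 (hgΩ _) hs1
        _ ≤ 4 * (3 / (M : ℝ) ^ 2) * Ω := by gcongr
    calc ‖((g' (y + e j + e j) : 𝔸) - g' (y + e j)) - ((g' (y + e j) : 𝔸) - g' y)‖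
        ≤ 4 * (3 / (M : ℝ) ^ 2) * Ω + 4 * (3 / (M : ℝ) ^ 2) * Ω := (norm_sub_le _ _).trans (add_le_add h2 h1)
      _ = 24 * Ω / (M : ℝ) ^ 2 := by ring
      _ ≤ 24 * Ω / (M : ℝ) ^ 2 + 36 * Ω ^ 2 / (M : ℝ) ^ 2 := by
          have : 0 ≤ 36 * Ω ^ 2 / (M : ℝ) ^ 2 := by positivity
          linarith
  · -- inside the block: three parameters of one geodesic
    have hy' : res M (y + e j) j = res M y j + 1 := by rw [res_add_e_self hM y j, if_neg h]
    have hfl' : y + e j - res M (y + e j) j • e j = y - res M y j • e j := floor_add_e_self_of_ne hM y j h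
    rw [step_succ hM hgU hgΩ hΩ4 hdef (y + e j), hfl', hy', step_succ hM hgU hgΩ hΩ4 hdef y, hdef y]
    have hr2 : res M y j + 2 ≤ (M : ℤ) := by omega
    have hs1 := sstep_step_le hM (r := res M y j) hr0 (by omega)
    have hs2 := sstep_lattice_second_diff_le hM hr0 hr2
    have hc : ((res M y j + 1 + 1 : ℤ) : ℝ) = ((res M y j + 2 : ℤ) : ℝ) := by push_cast; ring
    rw [hc]
    calc _ ≤ 4 * |(3 * (((res M y j + 2 : ℤ) : ℝ) / M) ^ 2 - 2 * (((res M y j + 2 : ℤ) : ℝ) / M) ^ 3)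
              - (3 * (((res M y j + 1 : ℤ) : ℝ) / M) ^ 2 - 2 * (((res M y j + 1 : ℤ) : ℝ) / M) ^ 3)
              - ((3 * (((res M y j + 1 : ℤ) : ℝ) / M) ^ 2 - 2 * (((res M y j + 1 : ℤ) : ℝ) / M) ^ 3)
                - (3 * (((res M y j : ℤ) : ℝ) / M) ^ 2 - 2 * (((res M y j : ℤ) : ℝ) / M) ^ 3))| * Ω
            + (4 * |(3 * (((res M y j + 1 : ℤ) : ℝ) / M) ^ 2 - 2 * (((res M y j + 1 : ℤ) : ℝ) / M) ^ 3)
              - (3 * (((res M y j : ℤ) : ℝ) / M) ^ 2 - 2 * (((res M y j : ℤ) : ℝ) / M) ^ 3)| * Ω) ^ 2 :=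
          norm_geo_param_pg_le (hgU _) (hgU _) hΩ4 (hgΩ _) hs1.2 (hs2.trans (by
            have hM2 : (2 : ℝ) ≤ M := by exact_mod_cast (show (2 : ℤ) ≤ M by omega)
            rw [div_le_iff₀ (by positivity)]
            nlinarith))
      _ ≤ 4 * (6 / (M : ℝ) ^ 2) * Ω + (4 * (3 / 2 / (M : ℝ)) * Ω) ^ 2 :=
          add_le_add (mul_le_mul_of_nonneg_right (mul_le_mul_of_nonneg_left hs2 (by norm_num)) hΩ0)
            (pow_le_pow_left₀ (by positivity) (mul_le_mul_of_nonneg_right (mul_le_mul_of_nonneg_left hs1.1 (by norm_num)) hΩ0) 2)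
      _ = 24 * Ω / (M : ℝ) ^ 2 + 36 * Ω ^ 2 / (M : ℝ) ^ 2 := by field_simp; ring

/-! ## §3 The other directions -/

omit [Nontrivial 𝔸] in
/-- `g′` at a translate `y + v` by a vector that keeps the `j`-offset: the same parameter, translated endpoints. [folklore] -/
theorem step_shift {v : Site d} (hres : ∀ y : Site d, res M (y + v) j = res M y j)
    (hfl : ∀ y : Site d, (y + v) - res M (y + v) j • e j = (y - res M y j • e j) + v)
    (hdef : ∀ y : Site d, g' y = geo (3 * (((res M y j : ℤ) : ℝ) / M) ^ 2 - 2 * (((res M y j : ℤ) : ℝ) / M) ^ 3)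
      (g (y - res M y j • e j)) (g (y - res M y j • e j + (M : ℤ) • e j))) (y : Site d) :
    g' (y + v) = geo (3 * (((res M y j : ℤ) : ℝ) / M) ^ 2 - 2 * (((res M y j : ℤ) : ℝ) / M) ^ 3)
      (g (y - res M y j • e j + v)) (g (y - res M y j • e j + (M : ℤ) • e j + v)) := by
  rw [hdef, hfl, hres, add_right_comm _ v]

/-- **SHARP first differences in a direction kept by the step**: for a translation `v` keeping the `j`-offset (a unit step
`e_μ`, `μ ≠ j`, or a coarse translation `M•e_κ`), if `‖g(y + v) − g y‖ ≤ l` for all `y` then `‖g′(y + v) − g′ y‖ ≤ (1 + 24Ω)·l`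
((154b) `norm_geo_sub_geo_sharp'`, `0 ≤ φ ≤ 1`). [folklore] -/
theorem step_shift_first (hM : 1 ≤ M) (hgU : ∀ y, g y ∈ unitaryUnits 𝔸)
    (hgΩ : ∀ y, ‖(g (y + (M : ℤ) • e j) : 𝔸) - g y‖ ≤ Ω) (hΩ4 : Ω ≤ 1 / 4)
    (hdef : ∀ y : Site d, g' y = geo (3 * (((res M y j : ℤ) : ℝ) / M) ^ 2 - 2 * (((res M y j : ℤ) : ℝ) / M) ^ 3)
      (g (y - res M y j • e j)) (g (y - res M y j • e j + (M : ℤ) • e j)))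
    {v : Site d} (hres : ∀ y : Site d, res M (y + v) j = res M y j)
    (hfl : ∀ y : Site d, (y + v) - res M (y + v) j • e j = (y - res M y j • e j) + v)
    {l : ℝ} (hl : ∀ y, ‖(g (y + v) : 𝔸) - g y‖ ≤ l) (y : Site d) :
    ‖(g' (y + v) : 𝔸) - g' y‖ ≤ (1 + 24 * Ω) * l := by
  have hΩ0 : 0 ≤ Ω := (norm_nonneg _).trans (hgΩ y)
  have hl0 : 0 ≤ l := (norm_nonneg _).trans (hl y)
  have hM0 : (0 : ℝ) < M := by exact_mod_cast hM
  have ht := sstep_mem (t := ((res M y j : ℤ) : ℝ) / M) (div_nonneg (by exact_mod_cast res_nonneg hM y j) hM0.le)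
    ((div_le_one hM0).2 (by exact_mod_cast (res_lt hM y j).le))
  rw [step_shift hres hfl hdef y, hdef y]
  have h := norm_geo_sub_geo_sharp' (hgU _) (hgU _) (hgU _) hΩ4 (hgΩ _) (by
      have := hgΩ (y - res M y j • e j + v); rwa [add_right_comm] at this) ht.1 ht.2 (hl _)
    (by have := hl (y - res M y j • e j + (M : ℤ) • e j); exact this)
  refine h.trans ?_
  have : (1 + 24 * (3 * (((res M y j : ℤ) : ℝ) / M) ^ 2 - 2 * (((res M y j : ℤ) : ℝ) / M) ^ 3) * Ω) ≤ 1 + 24 * Ω := by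
    nlinarith [ht.2]
  exact mul_le_mul_of_nonneg_right this hl0

/-- Unit steps in a direction `μ ≠ j` keep the `j`-offset and move the floor. [folklore] -/
theorem unit_step_keeps (hM : 1 ≤ M) {μ : Fin d} (hμ : μ ≠ j) :
    (∀ y : Site d, res M (y + e μ) j = res M y j) ∧
      (∀ y : Site d, (y + e μ) - res M (y + e μ) j • e j = (y - res M y j • e j) + e μ) :=
  ⟨fun y => res_add_e_ne hM y hμ.symm, fun y => floor_add_e_ne hM y hμ⟩

/-- Coarse translations `M•e_κ` keep the `j`-offset and move the floor. [folklore] -/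
theorem coarse_step_keeps (hM : 1 ≤ M) (κ : Fin d) :
    (∀ y : Site d, res M (y + (M : ℤ) • e κ) j = res M y j) ∧
      (∀ y : Site d, (y + (M : ℤ) • e κ) - res M (y + (M : ℤ) • e κ) j • e j = (y - res M y j • e j) + (M : ℤ) • e κ) := by
  constructor
  · intro y; have := (blk_res_add_period hM y 1 κ).2; rw [mul_one] at this; rw [this]
  · intro y; have := floor_add_period hM y j κ 1; rwa [mul_one] at this

/-- **Mixed second differences** (`j` and a unit step `e_τ`, `τ ≠ j`, with `‖g(y+e_τ) − g y‖ ≤ l`):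
`‖g′(y+e_j+e_τ) − g′(y+e_τ) − g′(y+e_j) + g′ y‖ ≤ (3∕(2M))·l·(4Ω(1+24Ω) + 8)`. [folklore] -/
theorem step_mixed_second (hM : 1 ≤ M) (hgU : ∀ y, g y ∈ unitaryUnits 𝔸)
    (hgΩ : ∀ y, ‖(g (y + (M : ℤ) • e j) : 𝔸) - g y‖ ≤ Ω) (hΩ4 : Ω ≤ 1 / 4)
    (hdef : ∀ y : Site d, g' y = geo (3 * (((res M y j : ℤ) : ℝ) / M) ^ 2 - 2 * (((res M y j : ℤ) : ℝ) / M) ^ 3)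
      (g (y - res M y j • e j)) (g (y - res M y j • e j + (M : ℤ) • e j)))
    {τ : Fin d} (hτ : τ ≠ j) {l : ℝ} (hl : ∀ y, ‖(g (y + e τ) : 𝔸) - g y‖ ≤ l) (y : Site d) :
    ‖(g' (y + e j + e τ) : 𝔸) - g' (y + e τ) - g' (y + e j) + g' y‖ ≤ 3 / 2 / (M : ℝ) * l * (4 * Ω * (1 + 24 * Ω) + 8) := by
  have hΩ0 : 0 ≤ Ω := (norm_nonneg _).trans (hgΩ y)
  have hl0 : 0 ≤ l := (norm_nonneg _).trans (hl y)
  have hM0 : (0 : ℝ) < M := by exact_mod_cast hM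
  have hr0 := res_nonneg hM y j
  have hrM : res M y j + 1 ≤ (M : ℤ) := by have := res_lt hM y j; omega
  have hs := sstep_step_le hM hr0 hrM
  have ht := sstep_mem (t := ((res M y j : ℤ) : ℝ) / M) (div_nonneg (by exact_mod_cast hr0) hM0.le)
    ((div_le_one hM0).2 (by exact_mod_cast (res_lt hM y j).le))
  obtain ⟨hres, hfl⟩ := unit_step_keeps hM hτ
  -- the four values: two parameters × two (translated) endpoint pairs
  have e4 : g' (y + e j + e τ) = geo (3 * (((res M y j + 1 : ℤ) : ℝ) / M) ^ 2 - 2 * (((res M y j + 1 : ℤ) : ℝ) / M) ^ 3)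
      (g (y - res M y j • e j + e τ)) (g (y - res M y j • e j + (M : ℤ) • e j + e τ)) := by
    rw [add_right_comm, step_succ hM hgU hgΩ hΩ4 hdef (y + e τ), hfl, hres, add_right_comm _ (e τ)]
  have e3 : g' (y + e τ) = _ := step_shift hres hfl hdef y
  have e2 := step_succ hM hgU hgΩ hΩ4 hdef y
  rw [e4, e3, e2, hdef y]
  have hreg : ∀ a b c d0 : 𝔸, a - b - c + d0 = (a - b) - (c - d0) := fun _ _ _ _ => by abel
  rw [hreg]
  have h := norm_geo_mixed_pg_le (hgU (y - res M y j • e j)) (hgU (y - res M y j • e j + (M : ℤ) • e j))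
    (hgU (y - res M y j • e j + e τ)) hΩ4 (hgΩ _)
    (by have := hgΩ (y - res M y j • e j + e τ); rwa [add_right_comm] at this) ht.1 ht.2 hs.2 (hl _)
    (by have := hl (y - res M y j • e j + (M : ℤ) • e j); exact this)
    (s' := 3 * (((res M y j + 1 : ℤ) : ℝ) / M) ^ 2 - 2 * (((res M y j + 1 : ℤ) : ℝ) / M) ^ 3)
  refine h.trans ?_
  have hpos : 0 ≤ l * (4 * Ω * (1 + 24 * Ω) + 8) := by positivity
  calc _ = |(3 * (((res M y j + 1 : ℤ) : ℝ) / M) ^ 2 - 2 * (((res M y j + 1 : ℤ) : ℝ) / M) ^ 3)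
            - (3 * (((res M y j : ℤ) : ℝ) / M) ^ 2 - 2 * (((res M y j : ℤ) : ℝ) / M) ^ 3)| * (l * (4 * Ω * (1 + 24 * Ω) + 8)) := by
          ring
    _ ≤ 3 / 2 / (M : ℝ) * (l * (4 * Ω * (1 + 24 * Ω) + 8)) := mul_le_mul_of_nonneg_right hs.1 hpos
    _ = 3 / 2 / (M : ℝ) * l * (4 * Ω * (1 + 24 * Ω) + 8) := by ring

/-- **SHARP second differences in two kept directions** `μ, τ ≠ j` (possibly equal): if `g` has `μ`-differences `≤ l`,
`τ`-differences `≤ m` and second differences `‖g(y+e_μ+e_τ) − g(y+e_τ) − g(y+e_μ) + g y‖ ≤ σ`, then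
`‖g′(y+e_μ+e_τ) − g′(y+e_τ) − g′(y+e_μ) + g′ y‖ ≤ σ + 53Ω·σ + 115·l·m` ((154b) `norm_pg_geo_le`, `0 ≤ φ ≤ 1`). [folklore] -/
theorem step_kept_second (hM : 1 ≤ M) (hgU : ∀ y, g y ∈ unitaryUnits 𝔸)
    (hgΩ : ∀ y, ‖(g (y + (M : ℤ) • e j) : 𝔸) - g y‖ ≤ Ω) (hΩ4 : Ω ≤ 1 / 4)
    (hdef : ∀ y : Site d, g' y = geo (3 * (((res M y j : ℤ) : ℝ) / M) ^ 2 - 2 * (((res M y j : ℤ) : ℝ) / M) ^ 3)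
      (g (y - res M y j • e j)) (g (y - res M y j • e j + (M : ℤ) • e j)))
    {μ τ : Fin d} (hμ : μ ≠ j) (hτ : τ ≠ j) {l m σ : ℝ}
    (hl : ∀ y, ‖(g (y + e μ) : 𝔸) - g y‖ ≤ l) (hm : ∀ y, ‖(g (y + e τ) : 𝔸) - g y‖ ≤ m)
    (hσ : ∀ y, ‖(g (y + e μ + e τ) : 𝔸) - g (y + e τ) - g (y + e μ) + g y‖ ≤ σ) (y : Site d) :
    ‖(g' (y + e μ + e τ) : 𝔸) - g' (y + e τ) - g' (y + e μ) + g' y‖ ≤ σ + 53 * Ω * σ + 115 * (l * m) := by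
  have hΩ0 : 0 ≤ Ω := (norm_nonneg _).trans (hgΩ y)
  have hl0 : 0 ≤ l := (norm_nonneg _).trans (hl y)
  have hm0 : 0 ≤ m := (norm_nonneg _).trans (hm y)
  have hσ0 : 0 ≤ σ := (norm_nonneg _).trans (hσ y)
  have hM0 : (0 : ℝ) < M := by exact_mod_cast hM
  have ht := sstep_mem (t := ((res M y j : ℤ) : ℝ) / M) (div_nonneg (by exact_mod_cast res_nonneg hM y j) hM0.le)
    ((div_le_one hM0).2 (by exact_mod_cast (res_lt hM y j).le))
  obtain ⟨hresμ, hflμ⟩ := unit_step_keeps hM hμ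
  obtain ⟨hresτ, hflτ⟩ := unit_step_keeps hM hτ
  set f : Site d := y - res M y j • e j with hf
  have e2 : g' (y + e μ) = _ := step_shift hresμ hflμ hdef y
  have e3 : g' (y + e τ) = _ := step_shift hresτ hflτ hdef y
  have e4 : g' (y + e μ + e τ) = geo (3 * (((res M y j : ℤ) : ℝ) / M) ^ 2 - 2 * (((res M y j : ℤ) : ℝ) / M) ^ 3)
      (g (f + e μ + e τ)) (g (f + (M : ℤ) • e j + e μ + e τ)) := by
    rw [step_shift hresτ hflτ hdef (y + e μ), hflμ, hresμ, ← hf, add_right_comm _ (e μ) ((M : ℤ) • e j)]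
  rw [e4, e3, e2, hdef y, ← hf]
  -- (154b) at the parallelogram of endpoint pairs based at `f`, `f + M e_j`
  have hc := fun (p : Site d) => hgU p
  have h := norm_pg_geo_le (s := 3 * (((res M y j : ℤ) : ℝ) / M) ^ 2 - 2 * (((res M y j : ℤ) : ℝ) / M) ^ 3)
    (hc f) (hc (f + e μ)) (hc (f + e τ)) (hc (f + e μ + e τ))
    (hc (f + (M : ℤ) • e j)) (hc (f + (M : ℤ) • e j + e μ)) (hc (f + (M : ℤ) • e j + e τ)) (hc (f + (M : ℤ) • e j + e μ + e τ))
    hΩ4 ht.1 ht.2 (hgΩ f)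
    (by have := hgΩ (f + e μ); rwa [add_right_comm] at this)
    (by have := hgΩ (f + e τ); rwa [add_right_comm] at this)
    (by have := hgΩ (f + e μ + e τ); rwa [add_right_comm (f + e μ), add_right_comm f] at this)
    (hl f) (by have := hl (f + e τ); rwa [add_right_comm] at this) (hm f) (hm (f + e μ))
    (hl (f + (M : ℤ) • e j)) (by have := hl (f + (M : ℤ) • e j + e τ); rwa [add_right_comm] at this)
    (hm (f + (M : ℤ) • e j)) (hm (f + (M : ℤ) • e j + e μ))
    (hσ f) (hσ (f + (M : ℤ) • e j))
  refine h.trans ?_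
  have hlm : 0 ≤ l * m := mul_nonneg hl0 hm0
  nlinarith [ht.1, ht.2, mul_nonneg hΩ0 hσ0]

end

end Summit.QuantumFields.BalabanUV.T4Continuum.NE7CornerGaugeStep
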